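import Summits.HodgeConjecture.CorCM.MultiFieldWeilEqualPrimes
import HarnessLib

/-!
# MULTI-FIELD WEIL ENGINE — JOINT PRIMES: CM fields of ONE prime relative degree on whose tuples of `τ`-embeddings `Aut(ℂ/k)` acts JOINTLY TRANSITIVELY (e.g. fields
# with linearly disjoint Galois closures) are peeled WITHOUT ANY ORDER — a counting argument (`ℓ^r ∤ (ℓ!)^{r−1}`) replaces the ordered automorphism hypothesis of
# `MultiFieldWeilEqualPrimes`; the defect law for a prime tower with repetitions over coprime one-member slots

Cell `pub-hodgecm2` (COR-CM), seat b30 gen 30 (2026-08-24); count-neutral own lane MULTI-FIELD WEIL ENGINE (stem `MultiFieldWeil*`), sequel of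
`CorCM/MultiFieldWeilEqualPrimes.lean` (`exists_orderOf_eq_of_trivial_on`, Wielandt + Cauchy) and `CorCM/MultiFieldWeilPrimeTower.lean` (`const_of_signed_primeTower_coprime`,
priority form).  Theorems only; no definition, no named fact, no `sorry`, no `decide`.  `HC_CM` is NOT asserted anywhere (this file has no Hodge-theoretic statement; the
headlines are in `CorCM/MultiFieldWeilJointPrimesHodge.lean`).

THE POINT.  `MultiFieldWeilEqualPrimes` peels slots of one prime size `ℓ` in an ORDER, asking that each be moved by an automorphism of `ℂ/k` fixing its predecessors.  The
SYMMETRIC hypothesis is JOINT TRANSITIVITY of the realised tuples on the `E`-tuples of points, `E` the set of tower slots of size `ℓ` (for the fields: `Aut(ℂ/τ(k))` carries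
any tuple of `τ`-embeddings `(s_m)_{m ∈ E}` to any other — true when the Galois closures are linearly disjoint, i.e. `⨂_k K_m` is a field).  Then (§1,
**`exists_trivial_on_ne_one_of_jointTransitive`**) for EVERY `m₀ ∈ E` some realised tuple is the identity on `E ∖ {m₀}` and not at `m₀`: the image `G` of the tuples in
`∏_{m ∈ E} Sym(ℓ)` has order divisible by `ℓ^{|E|}` (orbit–stabiliser), while an injective projection off `m₀` would make `|G|` divide `(ℓ!)^{|E|−1}`
(**`not_pow_succ_dvd_factorial_pow`**).  Feeding this to `exists_orderOf_eq_of_trivial_on_of_lt` (normal subgroup of the primitive slot image ⟹ transitive ⟹ Cauchy; power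
trick on the smaller slots) gives realised `ℓ`-cycles pure on ALL other slots of size `≤ ℓ` (§2, **`pure_realisedTuples_jointPrimeTower`**), which is the `hpure` input of
`const_of_signed_primeTower` for ANY priority refining the sizes — one is manufactured in **`exists_prio_refining`**.  §3: THE DEFECT LAW
**`exists_hasDefectsG_realisedTuples_of_jointPrimeTower_oneMember`** — one-member slots of pairwise coprime sizes below a tower of PRIME sizes with repetitions and ANY
types, joint transitivity within each size class, NO order, NO other hypothesis on the fields.
[cite: DixonMortimer1996, §1.6 and Thm. 1.6A] [cite: MoonenZarhin1995Duke, Thm. 2.4] [cite: Shimura1998, §18.2 Lemma (i)] [cite: GaoUllmo2025, Thm 3.1]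

## References
* [DixonMortimer1996] J. D. Dixon, B. Mortimer, *Permutation Groups*, GTM 163, §1.6, Thm. 1.6A.  [MoonenZarhin1995Duke] B. Moonen, Yu. Zarhin, Duke Math. J. 77 (1995),
  Thm. 2.4.  [Shimura1998] G. Shimura, *Abelian varieties with CM and modular functions*, §18.2 Lemma (i).  [GaoUllmo2025] Z. Gao, E. Ullmo, J. Inst. Math. Jussieu 25
  (2025), Thm 3.1.
-/

noncomputable section

open NumberField

namespace Summit.HodgeConjecture.CorCM.MultiFieldWeil

open Finset
open Summit.HodgeConjecture.CorCM.Census.MultiFieldWeil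

open scoped Classical

/-! ## §1 Joint transitivity on a class of equal prime size: the counting argument -/

section Group

variable {r : ℕ} {n : Fin r → ℕ} {R : Finset (PermsG n)}

/-- `ℓ^{k+1}` does not divide `(ℓ!)^k` for a prime `ℓ` (`ℓ ∤ (ℓ−1)!`). [folklore] -/
theorem not_pow_succ_dvd_factorial_pow {ℓ : ℕ} (hℓ : ℓ.Prime) (k : ℕ) : ¬ ℓ ^ (k + 1) ∣ (Nat.factorial ℓ) ^ k := by
  intro h
  rw [← Nat.mul_factorial_pred hℓ.ne_zero, mul_pow, pow_succ] at h
  have h1 : ℓ ∣ (Nat.factorial (ℓ - 1)) ^ k := (Nat.mul_dvd_mul_iff_left (pow_pos hℓ.pos k)).1 h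
  have h2 : ℓ ∣ Nat.factorial (ℓ - 1) := hℓ.dvd_of_dvd_pow h1
  have h3 := (hℓ.dvd_factorial).1 h2
  have := hℓ.two_le
  omega

/-- **JOINT TRANSITIVITY ON A SET `E` OF SLOTS OF ONE PRIME SIZE `ℓ` FORCES, FOR EACH `m₀ ∈ E`, A TUPLE TRIVIAL ON `E ∖ {m₀}` AND NON-TRIVIAL AT `m₀`.**
`R ⊆ ∏_m Sym(n_m)` product-closed, inverse-closed, non-empty; if `R` is transitive on the `E`-tuples of points then `ℓ^{|E|}` divides the order of its image `G` in
`∏_{m ∈ E} Sym(ℓ)`; were the projection of `G` off `m₀` injective, `|G|` would divide `(ℓ!)^{|E|−1}` — impossible.  So the kernel is non-trivial: this is the input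
`hex` of `exists_orderOf_eq_of_trivial_on`, with no ORDER among the equal-size slots. [cite: DixonMortimer1996, §1.6 and Thm. 1.6A] -/
theorem exists_trivial_on_ne_one_of_jointTransitive (hmul : ∀ π ∈ R, ∀ π' ∈ R, π * π' ∈ R) (hinv : ∀ π ∈ R, π⁻¹ ∈ R) (hne : R.Nonempty)
    (E : Finset (Fin r)) {ℓ : ℕ} (hℓ : ℓ.Prime) (hE : ∀ m ∈ E, n m = ℓ)
    (hJT : ∀ a b : (∀ m : ↥E, Fin (n m)), ∃ π ∈ R, ∀ m : ↥E, π m (a m) = b m)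
    {m₀ : Fin r} (hm₀ : m₀ ∈ E) :
    ∃ π ∈ R, (∀ m ∈ E, m ≠ m₀ → π m = 1) ∧ π m₀ ≠ 1 := by
  have h1 : (1 : PermsG n) ∈ R := one_mem_of_closed hmul hinv hne
  -- the image `G` of `R` in the tuples restricted to `E`
  let PE : Type := ∀ m : ↥E, Equiv.Perm (Fin (n m))
  let res : PermsG n → PE := fun π m => π m
  let G : Subgroup PE :=
    { carrier := {g | ∃ π ∈ R, res π = g}
      mul_mem' := fun {g g'} hg hg' => by
        obtain ⟨π, hπ, rfl⟩ := hg
        obtain ⟨π', hπ', rfl⟩ := hg'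
        exact ⟨π * π', hmul π hπ π' hπ', rfl⟩
      one_mem' := ⟨1, h1, rfl⟩
      inv_mem' := fun {g} hg => by
        obtain ⟨π, hπ, rfl⟩ := hg
        exact ⟨π⁻¹, hinv π hπ, rfl⟩ }
  -- dichotomy: is some non-trivial element of `G` trivial off `m₀`?
  by_cases hker : ∃ g : PE, g ∈ G ∧ g ≠ 1 ∧ ∀ m : ↥E, (m : Fin r) ≠ m₀ → g m = 1
  · obtain ⟨g, ⟨π, hπ, hπg⟩, hg1, hgoff⟩ := hker
    refine ⟨π, hπ, fun m hm hmm₀ => ?_, fun h0 => hg1 ?_⟩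
    · have h := hgoff ⟨m, hm⟩ hmm₀
      rw [← hπg] at h
      exact h
    · rw [← hπg]
      funext m
      by_cases hmm : (m : Fin r) = m₀
      · obtain ⟨m, hm⟩ := m
        change m = m₀ at hmm
        subst hmm
        exact h0
      · have h := hgoff m hmm
        rw [← hπg] at h
        exact h
  · exfalso
    have hker' : ∀ g : PE, g ∈ G → (∀ m : ↥E, (m : Fin r) ≠ m₀ → g m = 1) → g = 1 := by
      intro g hg hgoff
      by_contra hg1
      exact hker ⟨g, hg, hg1, hgoff⟩
    -- (a) `ℓ^{|E|}` divides `|G|`: transitivity on the `E`-tuples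
    let X : Type := ∀ m : ↥E, Fin (n m)
    haveI : MulAction.IsPretransitive G X := ⟨fun a b => by
      obtain ⟨π, hπ, hab⟩ := hJT a b
      exact ⟨⟨res π, π, hπ, rfl⟩, funext fun m => hab m⟩⟩
    let a₀ : X := fun m => ⟨0, by rw [hE m m.2]; exact hℓ.pos⟩
    have hX : Nat.card X = ℓ ^ E.card := by
      rw [Nat.card_eq_fintype_card, Fintype.card_pi]
      rw [Finset.prod_congr rfl fun (m : ↥E) _ => show Fintype.card (Fin (n m)) = ℓ by rw [Fintype.card_fin, hE m m.2],
        Finset.prod_const, Finset.card_univ, Fintype.card_coe]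
    have hidx : (MulAction.stabilizer G a₀).index = ℓ ^ E.card := by rw [MulAction.index_stabilizer_of_transitive, hX]
    have hdvd : ℓ ^ E.card ∣ Nat.card G :=
      ⟨Nat.card (MulAction.stabilizer G a₀), by rw [← (MulAction.stabilizer G a₀).index_mul_card, hidx]⟩
    -- (b) the projection off `m₀` is injective, so `|G|` divides `(ℓ!)^{|E|−1}`
    let PE' : Type := ∀ m : ↥(E.erase m₀), Equiv.Perm (Fin (n m))
    let φ : G →* PE' :=
      { toFun := fun g m => (g : PE) ⟨m, Finset.mem_of_mem_erase m.2⟩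
        map_one' := rfl
        map_mul' := fun _ _ => rfl }
    have hφ : Function.Injective φ := by
      intro g g' hgg'
      have hd : ((g : PE)⁻¹ * g') = 1 := by
        refine hker' _ (G.mul_mem (G.inv_mem g.2) g'.2) fun m hm => ?_
        have h := congrFun hgg' ⟨m, Finset.mem_erase.2 ⟨hm, m.2⟩⟩
        change (g : PE) m = (g' : PE) m at h
        rw [Pi.mul_apply, Pi.inv_apply, h, inv_mul_cancel]
      exact Subtype.ext (inv_mul_eq_one.1 hd)
    have hcardG : Nat.card G = Nat.card φ.range := Nat.card_congr (MonoidHom.ofInjective hφ).toEquiv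
    have hdvd' : Nat.card G ∣ Nat.card PE' := by
      rw [hcardG]
      exact φ.range.card_subgroup_dvd_card
    have hPE' : Nat.card PE' = (Nat.factorial ℓ) ^ (E.card - 1) := by
      rw [Nat.card_eq_fintype_card, Fintype.card_pi]
      rw [Finset.prod_congr rfl fun (m : ↥(E.erase m₀)) _ => show Fintype.card (Equiv.Perm (Fin (n m))) = Nat.factorial ℓ by
          rw [Fintype.card_perm, Fintype.card_fin, hE m (Finset.mem_of_mem_erase m.2)],
        Finset.prod_const, Finset.card_univ, Fintype.card_coe, Finset.card_erase_of_mem hm₀]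
    -- (c) contradiction
    have hcard : 0 < E.card := Finset.card_pos.2 ⟨m₀, hm₀⟩
    have h := hdvd.trans (hPE' ▸ hdvd')
    obtain ⟨k, hk⟩ : ∃ k, E.card = k + 1 := ⟨E.card - 1, by omega⟩
    rw [hk, Nat.add_sub_cancel] at h
    exact not_pow_succ_dvd_factorial_pow hℓ k h

/-- **A priority refining the sizes always exists**: an injective `prio : Fin r → ℕ` with `n m < n m' → prio m < prio m'` (hence `prio m < prio m' → n m ≤ n m'`) — the order
in which `const_of_signed_primeTower` peels a tower with repeated sizes once every slot has a pure rotation (`prio m = n m · (r+1) + m`). [folklore] -/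
theorem exists_prio_refining (n : Fin r → ℕ) :
    ∃ prio : Fin r → ℕ, Function.Injective prio ∧ (∀ m m', n m < n m' → prio m < prio m') ∧ (∀ m m', prio m < prio m' → n m ≤ n m') := by
  refine ⟨fun m => n m * (r + 1) + (m : ℕ), ?_, ?_, ?_⟩
  · have hmono : ∀ m m' : Fin r, n m < n m' → n m * (r + 1) + (m : ℕ) < n m' * (r + 1) + (m' : ℕ) := by
      intro m m' h
      have h1 : n m * (r + 1) + (r + 1) ≤ n m' * (r + 1) := by
        have := Nat.mul_le_mul_right (r + 1) (Nat.succ_le_of_lt h)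
        rwa [Nat.succ_mul] at this
      have h2 : (m : ℕ) < r + 1 := m.2.trans (Nat.lt_succ_self r)
      omega
    intro m m' h
    change n m * (r + 1) + (m : ℕ) = n m' * (r + 1) + (m' : ℕ) at h
    rcases lt_trichotomy (n m) (n m') with hlt | heq | hgt
    · exact absurd h (hmono m m' hlt).ne
    · rw [heq] at h
      exact Fin.ext (by omega)
    · exact absurd h.symm (hmono m' m hgt).ne
  · intro m m' h
    have h1 : n m * (r + 1) + (r + 1) ≤ n m' * (r + 1) := by
      have := Nat.mul_le_mul_right (r + 1) (Nat.succ_le_of_lt h)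
      rwa [Nat.succ_mul] at this
    have h2 : (m : ℕ) < r + 1 := m.2.trans (Nat.lt_succ_self r)
    show n m * (r + 1) + (m : ℕ) < n m' * (r + 1) + (m' : ℕ)
    omega
  · intro m m' h
    by_contra hlt
    have hlt' : n m' < n m := by omega
    have h1 : n m' * (r + 1) + (r + 1) ≤ n m * (r + 1) := by
      have := Nat.mul_le_mul_right (r + 1) (Nat.succ_le_of_lt hlt')
      rwa [Nat.succ_mul] at this
    have h2 : (m' : ℕ) < r + 1 := m'.2.trans (Nat.lt_succ_self r)
    change n m * (r + 1) + (m : ℕ) < n m' * (r + 1) + (m' : ℕ) at h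
    omega

end Group

/-! ## §2 Realised: joint transitivity of `Aut(ℂ/k)` on tuples of `τ`-embeddings -/

section Realised

variable {I : Type} {r : ℕ} {Kf : I → Type} [∀ i, Field (Kf i)] [∀ i, NumberField (Kf i)] {i₀ : I} {is : Fin r → I} {n : Fin r → ℕ}
  {e : ∀ m : Fin r, (Kf (is m) →+* ℂ) ≃ Fin (n m) × Bool} {τ : Kf i₀ →+* ℂ} {im : ∀ m : Fin r, Kf i₀ →+* Kf (is m)}
  (he_sign : ∀ (m : Fin r) (s : Kf (is m) →+* ℂ), (e m s).2 = true ↔ s.comp (im m) = τ)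

include he_sign in
/-- **Joint transitivity of `Aut(ℂ)` on the tuples of `τ`-embeddings of the fields of `E` gives joint transitivity of the realised tuples on the `E`-tuples of points.**
`hJ` quantifies over full families and constrains only the slots of `E`. [cite: Shimura1998, §18.2 Lemma (i)] -/
theorem jointTransitiveOn_realisedTuples (E : Finset (Fin r)) (hEne : E.Nonempty)
    (hJ : ∀ s s' : (∀ m : Fin r, Kf (is m) →+* ℂ), (∀ m ∈ E, (s m).comp (im m) = τ ∧ (s' m).comp (im m) = τ) →
      ∃ ρ : ℂ ≃+* ℂ, ∀ m ∈ E, (ρ : ℂ →+* ℂ).comp (s m) = s' m) :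
    ∀ a b : (∀ m : ↥E, Fin (n m)), ∃ π ∈ realisedTuples e τ, ∀ m : ↥E, π m (a m) = b m := by
  intro a b
  -- extend the `E`-tuples to full families of `τ`-embeddings (junk over `τ` off `E`)
  let s : ∀ m : Fin r, Kf (is m) →+* ℂ := fun m => if hm : m ∈ E then (e m).symm (a ⟨m, hm⟩, true) else (e m).symm ((e m (Classical.arbitrary _)).1, true)
  let s' : ∀ m : Fin r, Kf (is m) →+* ℂ := fun m => if hm : m ∈ E then (e m).symm (b ⟨m, hm⟩, true) else (e m).symm ((e m (Classical.arbitrary _)).1, true)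
  have hover : ∀ (m : Fin r) (c : Fin (n m)), ((e m).symm (c, true)).comp (im m) = τ := fun m c => (he_sign m _).1 (by rw [Equiv.apply_symm_apply])
  have hs : ∀ (m : Fin r) (hm : m ∈ E), s m = (e m).symm (a ⟨m, hm⟩, true) := fun m hm => dif_pos hm
  have hs' : ∀ (m : Fin r) (hm : m ∈ E), s' m = (e m).symm (b ⟨m, hm⟩, true) := fun m hm => dif_pos hm
  obtain ⟨ρ, hρ⟩ := hJ s s' fun m hm => by rw [hs m hm, hs' m hm]; exact ⟨hover m _, hover m _⟩
  -- `ρ` fixes `τ`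
  obtain ⟨m₁, hm₁⟩ := hEne
  have hρτ : (ρ : ℂ →+* ℂ).comp τ = τ := by
    have h := hρ m₁ hm₁
    rw [hs m₁ hm₁, hs' m₁ hm₁] at h
    calc (ρ : ℂ →+* ℂ).comp τ = ((ρ : ℂ →+* ℂ).comp ((e m₁).symm (a ⟨m₁, hm₁⟩, true))).comp (im m₁) := by rw [RingHom.comp_assoc, hover]
      _ = τ := by rw [h, hover]
  obtain ⟨π, hπ, hπρ⟩ := exists_mem_realisedTuples_of_comp_tau_eq (e := e) he_sign ρ hρτ
  refine ⟨π, hπ, fun m => ?_⟩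
  have h := hρ m m.2
  rw [hs m m.2, hs' m m.2, hπρ m (a m)] at h
  exact (Prod.mk.inj ((e m).symm.injective h)).1

include he_sign in
/-- **THE PURE ROTATIONS OF A JOINT PRIME TOWER, realised — no order.**  Tower slots (outside `L`) have PRIME sizes, each larger than every slot of `L`; within each size class
`{m ∉ L | n m = n m₀}` having at least two members, `Aut(ℂ/τ(k))` is JOINTLY TRANSITIVE on the tuples of `τ`-embeddings (`hJ`).  Then for every tower slot `m₀` some
realised tuple is the identity on `L` and on EVERY OTHER slot of size `≤ n m₀` outside `L`, with `m₀`-component of order `n m₀`.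
[cite: DixonMortimer1996, §1.6 and Thm. 1.6A] [cite: Shimura1998, §18.2 Lemma (i)] -/
theorem pure_realisedTuples_jointPrimeTower (L : Finset (Fin r)) (hpr : ∀ m, m ∉ L → (n m).Prime) (hLt : ∀ m ∈ L, ∀ m', m' ∉ L → n m < n m')
    (hJ : ∀ m₀, m₀ ∉ L → (∃ m, m ∉ L ∧ m ≠ m₀ ∧ n m = n m₀) →
      ∀ s s' : (∀ m : Fin r, Kf (is m) →+* ℂ), (∀ m, m ∉ L → n m = n m₀ → (s m).comp (im m) = τ ∧ (s' m).comp (im m) = τ) →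
        ∃ ρ : ℂ ≃+* ℂ, ∀ m, m ∉ L → n m = n m₀ → (ρ : ℂ →+* ℂ).comp (s m) = s' m) :
    ∀ m₀, m₀ ∉ L → ∃ ρ ∈ realisedTuples e τ, (∀ m ∈ L, ρ m = 1) ∧ (∀ m, m ∉ L → m ≠ m₀ → n m ≤ n m₀ → ρ m = 1) ∧ orderOf (ρ m₀) = n m₀ := by
  intro m₀ hm₀
  have hmul : ∀ π ∈ realisedTuples e τ, ∀ π' ∈ realisedTuples e τ, π * π' ∈ realisedTuples e τ :=
    fun π hπ π' hπ' => mul_mem_realisedTuples e τ hπ hπ'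
  have hinv : ∀ π ∈ realisedTuples e τ, π⁻¹ ∈ realisedTuples e τ := fun π hπ => inv_mem_realisedTuples hπ
  have hne : (realisedTuples e τ).Nonempty := realisedTuples_nonempty (e := e) he_sign
  -- the size class `E` of `m₀` and the smaller slots `M`
  set E : Finset (Fin r) := univ.filter fun m => m ∉ L ∧ n m = n m₀ with hE
  set M : Finset (Fin r) := univ.filter fun m => n m < n m₀ with hM
  have hMlt : ∀ m ∈ M, n m < n m₀ := fun m hm => by rw [hM] at hm; exact (Finset.mem_filter.1 hm).2
  have hm₀E : m₀ ∈ E := by rw [hE]; exact Finset.mem_filter.2 ⟨Finset.mem_univ _, hm₀, rfl⟩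
  have hEn : ∀ m ∈ E, n m = n m₀ := fun m hm => by rw [hE] at hm; exact (Finset.mem_filter.1 hm).2.2
  have key : ∃ ρ ∈ realisedTuples e τ, (∀ m ∈ E.erase m₀, ρ m = 1) ∧ (∀ m ∈ M, ρ m = 1) ∧ orderOf (ρ m₀) = n m₀ := by
    by_cases hEx : ∃ m, m ∉ L ∧ m ≠ m₀ ∧ n m = n m₀
    · -- joint transitivity on `E`, counting, Wielandt, Cauchy, power trick
      have hJT := jointTransitiveOn_realisedTuples (e := e) he_sign E ⟨m₀, hm₀E⟩ fun s s' hss' => by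
        obtain ⟨ρ, hρ⟩ := hJ m₀ hm₀ hEx s s' fun m hmL hmn => hss' m (by rw [hE]; exact Finset.mem_filter.2 ⟨Finset.mem_univ _, hmL, hmn⟩)
        exact ⟨ρ, fun m hm => by rw [hE] at hm; exact hρ m (Finset.mem_filter.1 hm).2.1 (Finset.mem_filter.1 hm).2.2⟩
      have hex := exists_trivial_on_ne_one_of_jointTransitive hmul hinv hne E (hpr m₀ hm₀) hEn hJT hm₀E
      have hex' : ∃ π ∈ realisedTuples e τ, (∀ m ∈ E.erase m₀, π m = 1) ∧ π m₀ ≠ 1 := by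
        obtain ⟨π, hπ, hπE, hπ0⟩ := hex
        exact ⟨π, hπ, fun m hm => hπE m (Finset.mem_of_mem_erase hm) (Finset.ne_of_mem_erase hm), hπ0⟩
      exact exists_orderOf_eq_of_trivial_on_of_lt hmul hinv hne (hpr m₀ hm₀) (fun a b => transitive_realisedTuples (e := e) he_sign m₀ a b) (E.erase m₀) M hMlt hex'
    · -- `m₀` alone in its class: Cauchy + power trick
      obtain ⟨ρ, hρ, hρM, hord⟩ := exists_pure_on_mem_realisedTuples (e := e) he_sign m₀ (hpr m₀ hm₀) M hMlt
      refine ⟨ρ, hρ, fun m hm => absurd ⟨m, ?_⟩ hEx, hρM, hord⟩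
      have hm' := Finset.mem_of_mem_erase hm
      rw [hE] at hm'
      exact ⟨(Finset.mem_filter.1 hm').2.1, Finset.ne_of_mem_erase hm, (Finset.mem_filter.1 hm').2.2⟩
  obtain ⟨ρ, hρ, hρE, hρM, hord⟩ := key
  refine ⟨ρ, hρ, fun m hm => hρM m (by rw [hM]; exact Finset.mem_filter.2 ⟨Finset.mem_univ _, hLt m hm m₀ hm₀⟩), fun m hmL hmm₀ hle => ?_, hord⟩
  rcases lt_or_eq_of_le hle with hlt | heq
  · exact hρM m (by rw [hM]; exact Finset.mem_filter.2 ⟨Finset.mem_univ _, hlt⟩)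
  · exact hρE m (Finset.mem_erase.2 ⟨hmm₀, by rw [hE]; exact Finset.mem_filter.2 ⟨Finset.mem_univ _, hmL, heq⟩⟩)

/-! ## §3 The defect law for a joint prime tower over coprime one-member slots -/

include he_sign in
/-- **THE DEFECT LAW — JOINT PRIME TOWER (repeated primes, NO order) OVER ONE-MEMBER SLOTS OF PAIRWISE COPRIME SIZES.**  `L`: one-member position sets, pairwise
coprime sizes; outside `L`: PRIME sizes larger than those of `L`, proper non-empty position sets, and joint transitivity of `Aut(ℂ/τ(k))` on the tuples of `τ`-embeddings
within each size class of at least two slots (`hJ`).  Every configuration balanced under the realised tuples obeys the defect law with any `c m = n m − 2|P m|` (as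
integers).  NO other hypothesis on the fields. [cite: MoonenZarhin1995Duke, Thm. 2.4] [cite: DixonMortimer1996, §1.6 and Thm. 1.6A] [cite: GaoUllmo2025, Thm 3.1] -/
theorem exists_hasDefectsG_realisedTuples_of_jointPrimeTower_oneMember (L : Finset (Fin r))
    (hpr : ∀ m, m ∉ L → (n m).Prime) (hLt : ∀ m ∈ L, ∀ m', m' ∉ L → n m < n m')
    (hcop : ∀ m ∈ L, ∀ m' ∈ L, m ≠ m' → (n m).Coprime (n m'))
    (hJ : ∀ m₀, m₀ ∉ L → (∃ m, m ∉ L ∧ m ≠ m₀ ∧ n m = n m₀) →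
      ∀ s s' : (∀ m : Fin r, Kf (is m) →+* ℂ), (∀ m, m ∉ L → n m = n m₀ → (s m).comp (im m) = τ ∧ (s' m).comp (im m) = τ) →
        ∃ ρ : ℂ ≃+* ℂ, ∀ m, m ∉ L → n m = n m₀ → (ρ : ℂ →+* ℂ).comp (s m) = s' m)
    {P : ∀ m : Fin r, Finset (Fin (n m))} (hP1 : ∀ m ∈ L, ∃ p : Fin (n m), P m = {p})
    (hP0 : ∀ m, m ∉ L → (P m).Nonempty) (hPn : ∀ m, m ∉ L → (P m).card < n m)
    (c : Fin r → ℕ) (hc : ∀ m, ((c m : ℕ) : ℤ) = (n m : ℤ) - 2 * (P m).card)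
    {α : Type} (v : α → PtG n) (T : Finset α) (hT : ModelBalancedG P (realisedTuples e τ) v T) :
    ∃ t : Fin r → ℤ, HasDefectsG c v T t := by
  have hmul : ∀ π ∈ realisedTuples e τ, ∀ π' ∈ realisedTuples e τ, π * π' ∈ realisedTuples e τ :=
    fun π hπ π' hπ' => mul_mem_realisedTuples e τ hπ hπ'
  have hinv : ∀ π ∈ realisedTuples e τ, π⁻¹ ∈ realisedTuples e τ := fun π hπ => inv_mem_realisedTuples hπ
  have hne : (realisedTuples e τ).Nonempty := realisedTuples_nonempty (e := e) he_sign
  have htrans : ∀ (m : Fin r) (a b : Fin (n m)), ∃ π ∈ realisedTuples e τ, π m a = b := fun m a b =>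
    transitive_realisedTuples (e := e) he_sign m a b
  -- a priority refining the sizes; the pure rotations serve it
  obtain ⟨prio, hinj, hmono, hle⟩ := exists_prio_refining n
  have hpure := pure_realisedTuples_jointPrimeTower (e := e) he_sign L hpr hLt hJ
  have hconst := const_of_signed_primeTower_coprime (P := P) hmul hinv hne L prio hpr (fun m m' _ _ h => hinj h) hP0 hPn
    (fun m₀ hm₀ => by
      obtain ⟨ρ, hρ, hρL, hρle, hord⟩ := hpure m₀ hm₀
      exact ⟨ρ, hρ, hρL, fun m hmL hlt => hρle m hmL (fun h => by rw [h] at hlt; exact lt_irrefl _ hlt) (hle m m₀ hlt), hord⟩)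
    (fun m hm m' hm' hmm' => by
      obtain ⟨p, hp⟩ := hP1 m hm
      obtain ⟨p', hp'⟩ := hP1 m' hm'
      rw [card_orbitG_singleton hp (htrans m), card_orbitG_singleton hp' (htrans m')]
      exact hcop m hm m' hm' hmm')
    (fun m hm f hf => by
      obtain ⟨p, hp⟩ := hP1 m hm
      exact sep_of_singletons (fun a => singleton_mem_orbitG hp (htrans m) a) f hf)
    fun π hπ => signed_of_modelBalancedG (realisedTuples e τ) v hT hπ
  obtain ⟨t, hd, he'⟩ := exists_defects_of_const (P := P) hne hconst fun π hπ => signed_of_modelBalancedG (realisedTuples e τ) v hT hπ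
  refine ⟨t, fun m a => hd m a, ?_⟩
  rw [he']
  exact Finset.sum_congr rfl fun m _ => by rw [hc m]

end Realised

end Summit.HodgeConjecture.CorCM.MultiFieldWeil

end
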